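import Summits.QuantumFields.QCD.Theses.GapBuysCauchyRate

/-!
# Route GapBuysCauchyRate — RateGivesGap (item stmt-QuantumFields-11527)

Support item of route `route-QuantumFields-GapBuysCauchyRate` (sub-problem `QCD` of the summit
`QuantumFields`): the rate crux `LadderCauchyRate` implies the shared lattice half `FullLatticeGap`.

`LadderCauchyRate` hands, for `N_f = 2` and `N_f = 3`, a mass-independent regularisation `reg` with
`HasMassScaling` and two-loop `HasAsymptoticScaling`, a calibrated species family `𝒞` and, for every
positive mass tuple `m`, (i) the physical-branch clause and (ii) a uniform lattice gap — both stated
for the scheme `𝒞.scheme m = reg.scheme m (𝒞.z m) (𝒞.shift m)`.  `FullLatticeGap` asks for the same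
two clauses for `reg.scheme m 0 0`.  The bare-mass trajectory `mq` and the lattice-gap predicate
`QCDScheme.HasLatticeMassGap` read only the fields `a`, `β`, `L`, `mq` of a scheme, which
`QCDRegularisation.scheme reg m z shift` fills independently of the species renormalisations
`(z, shift)`; hence both clauses coincide DEFINITIONALLY for the two schemes (projection/ι-reduction)
and the proof is a repackaging of hypotheses (the same observation is recorded, for the lattice-gap
clause, as `RobustYangMillsHandover.Negative.hasLatticeMassGap_scheme_indep`; here plain `exact`
suffices, so nothing is imported or restated).  No analysis, no named facts;
axioms ⊆ {propext, Classical.choice, Quot.sound}.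

References: I. Montvay, G. Münster, *Quantum fields on a lattice* (CUP 1994), §5.1 (Wilson quark
masses, critical hopping parameter); idea card QuantumFields/QCD/gap-buys-the-cauchy-rate.
-/

namespace Summit.QuantumFields.QCD.Theorems

open Summit.QuantumFields.QCD.Theses.GapBuysCauchyRate

/-- **RateGivesGap** (item stmt-QuantumFields-11527): `LadderCauchyRate → FullLatticeGap`.
Proof: for `N_f ∈ {2, 3}` take the regularisation `reg`, the mass-scaling and asymptotic-scaling
witnesses and the calibrated family `𝒞` from `LadderCauchyRate`; for a positive mass tuple `m` its
clauses (i) (physical branch) and (ii) (uniform lattice gap) for `𝒞.scheme m =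
reg.scheme m (𝒞.z m) (𝒞.shift m)` are definitionally the corresponding clauses for
`reg.scheme m 0 0`, because `mq` and `HasLatticeMassGap` ignore `(z, shift)`. [folklore] -/
theorem rateGivesGap_proof : Summit.QuantumFields.QCD.Theses.GapBuysCauchyRate.RateGivesGap := by
  unfold Summit.QuantumFields.QCD.Theses.GapBuysCauchyRate.RateGivesGap
  intro hL Nf hNf
  obtain ⟨reg, hms, hAS, 𝒞, r, -, H⟩ := hL Nf hNf
  refine ⟨reg, hms, hAS, fun m hm => ?_⟩
  obtain ⟨hbr, ⟨Δ, hΔ, hgap⟩, -⟩ := H m hm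
  refine ⟨fun f => ?_, Δ, hΔ, ?_⟩
  · -- `(𝒞.scheme m).mq` and `(reg.scheme m 0 0).mq` are the same term after projection reduction
    exact hbr f
  · -- `QCDScheme.HasLatticeMassGap` reads only `a`, `β`, `L`, `mq`, which ignore `(z, shift)`
    exact hgap

end Summit.QuantumFields.QCD.Theorems
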